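import Summits.QuantumFields.YangMills.Theorems.FluctuationComparisonRegPrIntLOddsLedgerVers
import HarnessLib

/-!
# `FluctuationComparisonRegPrIntLOddsLedgerPregLow` — PREG OF LINE g20-2 «ODDS LEDGER» AT THE SHALLOW END `M = 0`, AND THE TWO SHARED LEMMAS OF THE PREG SPLIT
# (crux `UnitScaleTilt.FluctuationComparisonRegPrIntL`, stmt-QuantumFields-20520; organ LFR♯ᶜ; line file `Cruxes/…/Lines/odds_ledger.lean` v1.2)

Cell `ym3-torus` (YM ladder rung R3 = continuum SU(2) Yang–Mills on T³ — a RUNG, NOT the Clay problem: not d = 4, not infinite volume, not a mass gap);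
width seat `ym3-torus-px16` (gen 12); helper `--supports stmt-QuantumFields-20520`; ★★OWNER WORD 62 (b) «px16 = PREG′-LOW-END (`M = 0` under LFR♯ᶜ's
`(ν, ρ)` prefix) + shared lemmas (a) a.e.-monotonicity of `heightDensity` in the event, (c) open-set `canonVersion` comparison» (PREG-TOP `K − J ≤ M` and the
regularity DOOR are `ym3-torus-px21` g12's twin-free file).  THEOREMS ONLY (0 `def`, 0 `sorry`, default heartbeats).

WHAT.  LINE g20-2 proves LFR♯ᶜ ⟸ VERS ∧ PREG ∧ LEV; **PREG `PartialWindowPositivityCan`** asks that every PARTIAL canonical density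
`q_M = canonVersion (heightDensity^{histGoodBelow M})` be positive on the window `W_J = {PlaqSmall θ_J}`.  The cell's reading (px21 g12 «PREG splits by depth»,
px16 g12 LOCATE-PREG, ★★OWNER WORD 62 (a): RULING №32 (α′) class): `q_M U` is read POINTWISE, and off `Node00.regSet` the canonical version IS the
Radon–Nikodym tower `heightDensity` (`canonVersion_eq_of_not_mem`), so PREG at depth `M` is exactly window-regularity at depth `M`; at `M = 0`
(`histGoodBelow 0 = univ`, the FULL descended density) the row carries no `(ν, ρ)` hypothesis and is not closable as lettered for `K > J`.  This file proves:
* §1 (generic `Node00` currency, shared) `subset_regSet_of_ae_eq_on` — regularity and the canonical version TRANSFER along an a.e. equality on an open set;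
  ★`canonVersion_le_of_ae_le_on` — on an open set inside both maximal regular sets an a.e. inequality of the classes is a POINTWISE inequality of the
  canonical versions (open-positivity of the reference measure);
* §2 (shared) ★`heightDensity_mono_ae` — Bałaban's restricted height density is a.e.-MONOTONE in the event (`(D_{J,K})_*(Gibbs_K|S) ≤ (D_{J,K})_*(Gibbs_K|S′)`,
  ✓`map_descendTo_restrict_eq_withDensity`, `ae_le_of_forall_setLIntegral_le_of_sigmaFinite`);
* §3 (the shallow end) ★`subset_regSet_heightDensity_univ_of_version` — a continuous positive window version `ρ` of the nested law `ν_{K,J}` (LFR♯ᶜ's ∕ VERS's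
  hypothesis; ✓`…OddsLedgerVers.tower_eq_map_descendTo`) puts the window inside `regSet (heightDensity^{univ})` with canonical version `Z_K·ρ` there;
  ★★`partialWindowPositivity_zero` — PREG's conclusion at depth `M = 0` (the line's `partialDensityCan … 0`, written out over ✓`…WregGlue.heightDensityCan`,
  `δ`-equal to the line's) WITH VERS's `(ν, ρ)` PREFIX, for every family, every `γ > 0`, every `J ≤ K` (no regime).
The knit «PREG′ at both ends ⇒ PREG′ at every depth on the first rung `K = J + 1`» follows over this file and px21's PREG-TOP (WORD 62 (e)); the interior depths
`0 < M < K − J` (free LARGE intermediate fields, outside the WREG port's charted set) are the unlocated row PWREG (WORD 62 (c)) and are NOT touched.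

HONEST SCOPE.  Measure-theoretic bookkeeping; PREG as published (no `(ν, ρ)` hypothesis) is NOT proved; PREG-TOP is px21's; PWREG, LEV (XL), LFR♯ᶜ, S2β,
the crux 20520 and the rung `YM3TorusSU2` are NOT proved; no summit statement is proved; the Yang–Mills mass gap is NOT proved.
References: [Balaban1985UV3] (2) p. 256, (6)–(7) p. 257, (41) p. 266; [Balaban1987RG1] (0.11) p. 253, (0.13) p. 254.
-/

noncomputable section

set_option autoImplicit false

open MeasureTheory Filter Topology Set
open scoped ENNReal NNReal
open Literature.MathematicalPhysics.QuantumFieldTheory.Balaban1983to89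
open Literature.MathematicalPhysics.QuantumFieldTheory.Balaban1983to89.T3ContinuumYM3Torus
open Literature.MathematicalPhysics.QuantumFieldTheory.Balaban1983to89.T3NestedUnitLaws
open Literature.MathematicalPhysics.QuantumFieldTheory.Balaban1983to89.T3UnitLawDensityEML
open Literature.MathematicalPhysics.QuantumFieldTheory.Balaban1983to89.T3UnitScaleTilt
open Literature.MathematicalPhysics.QuantumFieldTheory.Balaban1983to89.T3TiltDescent
open Literature.MathematicalPhysics.QuantumFieldTheory.Balaban1983to89.Missing
open scoped Literature.MathematicalPhysics.QuantumFieldTheory.Balaban1983to89.T3OrbitAverage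
open Summit.QuantumFields.YangMills.Theorems.FluctuationComparisonRegPrIntLWregGlue (heightDensityCan)
open Summit.QuantumFields.YangMills.Theorems.FluctuationComparisonRegPrIntLWregAssembly (isOpen_setOf_plaqSmall₂)
open Summit.QuantumFields.YangMills.Theorems.FluctuationComparisonRegPrIntLOddsLedgerVers (tower_eq_map_descendTo)

namespace Summit.QuantumFields.YangMills.Theorems.FluctuationComparisonRegPrIntLOddsLedgerPregLow

/-! ## §1 Canonical versions: transfer along an a.e. equality on an open set; pointwise comparison on open regular sets -/

section Canon

variable {α : Type*} [TopologicalSpace α] [MeasurableSpace α] [SecondCountableTopology α] [OpensMeasurableSpace α]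
  {μ : Measure α} [μ.IsOpenPosMeasure]

/-- **TRANSFER**: if `U` is open, `U ⊆ regSet μ f₁` and `f₁ = f₂` a.e. ON `U`, then `U ⊆ regSet μ f₂` and the two canonical versions agree at every point of `U`
(the canonical version of `f₁` is a continuous version of `f₂` on `U`). [cite: Balaban1987RG1, (0.13) p.254 (bookkeeping)] -/
theorem subset_regSet_of_ae_eq_on {f₁ f₂ : α → ℝ} {U : Set α} (hU : IsOpen U) (h₁ : U ⊆ Node00.regSet μ f₁)
    (h : f₁ =ᵐ[μ.restrict U] f₂) :
    U ⊆ Node00.regSet μ f₂ ∧ EqOn (Node00.canonVersion μ f₂) (Node00.canonVersion μ f₁) U := by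
  have hc : ContinuousOn (Node00.canonVersion μ f₁) U := Node00.continuousOn_canonVersion.mono h₁
  have h0 : Node00.canonVersion μ f₁ =ᵐ[μ.restrict U] f₁ := ae_restrict_of_ae (Node00.canonVersion_ae_eq (μ := μ) (f := f₁))
  have hae : Node00.canonVersion μ f₁ =ᵐ[μ.restrict U] f₂ := h0.trans h
  exact ⟨Node00.subset_regSet hU ⟨_, hc, hae⟩, Node00.canonVersion_eqOn_of_continuousOn hU hc hae⟩

/-- ★ **POINTWISE COMPARISON OF CANONICAL VERSIONS**: on an open `U` inside both maximal regular sets, `f ≤ g` a.e. on `U` gives `canonVersion μ f ≤ canonVersion μ g`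
at EVERY point of `U` — both versions are continuous on `U`, the strict superlevel set of their difference is open in `U` and `μ`-null, hence empty for an
open-positive `μ`. [cite: Balaban1987RG1, (0.13) p.254 (bookkeeping)] -/
theorem canonVersion_le_of_ae_le_on {f g : α → ℝ} {U : Set α} (hU : IsOpen U) (hf : U ⊆ Node00.regSet μ f) (hg : U ⊆ Node00.regSet μ g)
    (hle : f ≤ᵐ[μ.restrict U] g) {x : α} (hx : x ∈ U) : Node00.canonVersion μ f x ≤ Node00.canonVersion μ g x := by
  set Fc := Node00.canonVersion μ f with hFc
  set Gc := Node00.canonVersion μ g with hGc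
  have hFcont : ContinuousOn Fc U := Node00.continuousOn_canonVersion.mono hf
  have hGcont : ContinuousOn Gc U := Node00.continuousOn_canonVersion.mono hg
  have hae : ∀ᵐ y ∂μ.restrict U, Fc y ≤ Gc y := by
    filter_upwards [ae_restrict_of_ae (Node00.canonVersion_ae_eq (μ := μ) (f := f)),
      ae_restrict_of_ae (Node00.canonVersion_ae_eq (μ := μ) (f := g)), hle] with y h1 h2 h3
    rw [hFc, hGc, h1, h2]
    exact h3
  -- the bad set is open and null
  have hVo : IsOpen (U ∩ (fun y => Fc y - Gc y) ⁻¹' Ioi 0) := (hFcont.sub hGcont).isOpen_inter_preimage hU isOpen_Ioi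
  have hVnull : μ (U ∩ (fun y => Fc y - Gc y) ⁻¹' Ioi 0) = 0 := by
    have h' : ∀ᵐ y ∂μ, y ∈ U → Fc y ≤ Gc y := (ae_restrict_iff' hU.measurableSet).mp hae
    rw [ae_iff] at h'
    refine measure_mono_null (fun y hy => ?_) h'
    obtain ⟨hyU, hy⟩ := hy
    have hy' : 0 < Fc y - Gc y := hy
    exact fun himp => absurd (himp hyU) (not_le.mpr (by linarith))
  have hVempty : U ∩ (fun y => Fc y - Gc y) ⁻¹' Ioi 0 = ∅ := (hVo.measure_eq_zero_iff μ).mp hVnull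
  by_contra hlt
  have hxV : x ∈ U ∩ (fun y => Fc y - Gc y) ⁻¹' Ioi 0 := ⟨hx, by
    show 0 < Fc x - Gc x
    linarith [not_le.mp hlt]⟩
  rw [hVempty] at hxV
  exact hxV

end Canon

/-! ## §2 Bałaban's restricted height density: a.e.-monotone in the event (shared lemma (a)) -/

section Height

variable (F : T3Family) {γ : ℝ} {J K : ℕ} (hJK : J ≤ K)

/-- ★ **MONOTONICITY A.E. IN THE EVENT**: `S ⊆ S′` ⇒ `heightDensity^{S} ≤ heightDensity^{S′}` a.e. for product Haar — the descended restricted Gibbs measures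
compare (`restrict_mono`, `map_mono`) and both have the `withDensity` presentation ✓`map_descendTo_restrict_eq_withDensity`.
[cite: Balaban1985UV3, (2) p.256 and (6)-(7) p.257] -/
theorem heightDensity_mono_ae {S S' : Set (GaugeField (F.P K) 0 (Matrix.specialUnitaryGroup (Fin 2) ℂ))} (hS : MeasurableSet S)
    (hS' : MeasurableSet S') (hSS' : S ⊆ S') (hγ : 0 ≤ γ) :
    heightDensity F γ hJK S ≤ᵐ[fieldMeasure (F.P J) 0 (Matrix.specialUnitaryGroup (Fin 2) ℂ)] heightDensity F γ hJK S' := by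
  set μ := fieldMeasure (F.P J) 0 (Matrix.specialUnitaryGroup (Fin 2) ℂ) with hμ
  set Z : ℝ := partitionFn (G := Matrix.specialUnitaryGroup (Fin 2) ℂ) (F.P K) ((F.scheme ℰp γ).β K) with hZ
  have hZpos : 0 < Z := partitionFn_pos' _ (F.scheme_β_nonneg ℰp hγ K)
  obtain ⟨hDm, -⟩ := heightDensity_props F hJK hS hγ
  have hle : Measure.map (descendTo F ℰp J K hJK) ((gibbsK F ℰp γ K).restrict S) ≤
      Measure.map (descendTo F ℰp J K hJK) ((gibbsK F ℰp γ K).restrict S') :=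
    Measure.map_mono (Measure.restrict_mono hSS' le_rfl) (measurable_descendTo F ℰp measurableE_ℰp hJK)
  rw [map_descendTo_restrict_eq_withDensity F hJK hS hγ, map_descendTo_restrict_eq_withDensity F hJK hS' hγ] at hle
  have hae : (fun V => ENNReal.ofReal (Z⁻¹ * heightDensity F γ hJK S V)) ≤ᵐ[μ]
      fun V => ENNReal.ofReal (Z⁻¹ * heightDensity F γ hJK S' V) := by
    refine ae_le_of_forall_setLIntegral_le_of_sigmaFinite (hDm.const_mul _).ennreal_ofReal fun s hs _ => ?_
    rw [← withDensity_apply _ hs, ← withDensity_apply _ hs]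
    exact Measure.le_iff'.1 hle s
  filter_upwards [hae] with V hV
  have h0' : 0 ≤ Z⁻¹ * heightDensity F γ hJK S' V := mul_nonneg (inv_nonneg.mpr hZpos.le) (heightDensity_nonneg F γ hJK _ V)
  have h1 := (ENNReal.ofReal_le_ofReal_iff h0').mp hV
  exact le_of_mul_le_mul_left h1 (inv_pos.mpr hZpos)

end Height

/-! ## §3 The shallow end `M = 0`: a window version of the nested law -/

section Shallow

/-- ★ **REGULARITY AT THE SHALLOW END `M = 0` FROM A WINDOW VERSION** (every `γ > 0`, no regime): if the nested law `ν_{K,J}` (`ν K K = Gibbs_K`,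
`ν K j = (descend j)_* ν K (j+1)`) has a continuous positive version `ρ` on the window, then the window lies in `regSet (heightDensity^{univ})` and the
canonical version IS `Z_K·ρ` there (VERS's identification: ✓`tower_eq_map_descendTo`, ✓`map_descendTo_restrict_eq_withDensity` at `S = univ`).
[cite: Balaban1985UV3, (2) p.256 and (6) p.257; Balaban1987RG1, (0.13) p.254] -/
theorem subset_regSet_heightDensity_univ_of_version (F : T3Family) {γ : ℝ} (b₀ p₀ : ℝ) (hγ : 0 < γ)
    (ν : ℕ → (j : ℕ) → Measure (GaugeField (F.P j) 0 (Matrix.specialUnitaryGroup (Fin 2) ℂ)))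
    (hKK : ∀ K, ν K K = T4GenFunBounds.gibbsMeasure (F.P K) ((F.scheme ℰp γ).β K))
    (hstep : ∀ K j, j < K → ν K j = Measure.map (descend F ℰp j) (ν K (j + 1)))
    {J K : ℕ} (hJK : J ≤ K) (ρ : GaugeField (F.P J) 0 (Matrix.specialUnitaryGroup (Fin 2) ℂ) → ℝ)
    (hρpos : ∀ U, PlaqSmall (θBal F.L γ b₀ p₀ J) U → 0 < ρ U)
    (hν : ν K J = (fieldMeasure _ _ _).withDensity (fun U => ENNReal.ofReal (ρ U)))
    (hρc : ContinuousOn ρ {U | PlaqSmall (θBal F.L γ b₀ p₀ J) U}) :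
    {U : GaugeField (F.P J) 0 (Matrix.specialUnitaryGroup (Fin 2) ℂ) | PlaqSmall (θBal F.L γ b₀ p₀ J) U} ⊆
        Node00.regSet (fieldMeasure (F.P J) 0 (Matrix.specialUnitaryGroup (Fin 2) ℂ))
          (heightDensity F γ hJK (Set.univ : Set (GaugeField (F.P K) 0 (Matrix.specialUnitaryGroup (Fin 2) ℂ)))) ∧
      EqOn (heightDensityCan F γ hJK (Set.univ : Set (GaugeField (F.P K) 0 (Matrix.specialUnitaryGroup (Fin 2) ℂ))))
        (fun U => partitionFn (G := Matrix.specialUnitaryGroup (Fin 2) ℂ) (F.P K) ((F.scheme ℰp γ).β K) * ρ U)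
        {U : GaugeField (F.P J) 0 (Matrix.specialUnitaryGroup (Fin 2) ℂ) | PlaqSmall (θBal F.L γ b₀ p₀ J) U} := by
  haveI := B12ContinuousTransportInvariance.isOpenPosMeasure_fieldMeasure_SU (N := 2) (F.P J) 0
  set μ := fieldMeasure (F.P J) 0 (Matrix.specialUnitaryGroup (Fin 2) ℂ) with hμ
  set W : Set (GaugeField (F.P J) 0 (Matrix.specialUnitaryGroup (Fin 2) ℂ)) := {U | PlaqSmall (θBal F.L γ b₀ p₀ J) U} with hW
  set Z : ℝ := partitionFn (G := Matrix.specialUnitaryGroup (Fin 2) ℂ) (F.P K) ((F.scheme ℰp γ).β K) with hZ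
  set hD := heightDensity F γ hJK (Set.univ : Set (GaugeField (F.P K) 0 (Matrix.specialUnitaryGroup (Fin 2) ℂ))) with hhD
  have hZpos : 0 < Z := partitionFn_pos' _ (F.scheme_β_nonneg ℰp hγ.le K)
  have hWo : IsOpen W := isOpen_setOf_plaqSmall₂ (F.P J) 0 _
  have hWm : MeasurableSet W := hWo.measurableSet
  obtain ⟨hDm, -⟩ := heightDensity_props F hJK (S := (Set.univ : Set (GaugeField (F.P K) 0 (Matrix.specialUnitaryGroup (Fin 2) ℂ))))
    MeasurableSet.univ hγ.le
  have h1 : ν K J = μ.withDensity (fun U => ENNReal.ofReal (Z⁻¹ * hD U)) := by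
    rw [tower_eq_map_descendTo F γ ν hKK hstep hJK, ← Measure.restrict_univ (μ := gibbsK F ℰp γ K)]
    exact map_descendTo_restrict_eq_withDensity F hJK MeasurableSet.univ hγ.le
  have h2 : (μ.restrict W).withDensity (fun U => ENNReal.ofReal (ρ U)) = (μ.restrict W).withDensity (fun U => ENNReal.ofReal (Z⁻¹ * hD U)) := by
    rw [← restrict_withDensity hWm, ← restrict_withDensity hWm, ← hν, h1]
  have hρm : AEMeasurable (fun U => ENNReal.ofReal (ρ U)) (μ.restrict W) := (hρc.aemeasurable hWm).ennreal_ofReal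
  have hgm : AEMeasurable (fun U => ENNReal.ofReal (Z⁻¹ * hD U)) (μ.restrict W) := (hDm.const_mul _).ennreal_ofReal.aemeasurable
  have hae : (fun U => ENNReal.ofReal (ρ U)) =ᵐ[μ.restrict W] fun U => ENNReal.ofReal (Z⁻¹ * hD U) :=
    (withDensity_eq_iff_of_sigmaFinite hρm hgm).mp h2
  have hae' : (fun U => Z * ρ U) =ᵐ[μ.restrict W] hD := by
    filter_upwards [hae, ae_restrict_mem hWm] with U hU hUW
    have hρ0 : 0 ≤ ρ U := (hρpos U hUW).le
    have hg0 : 0 ≤ Z⁻¹ * hD U := mul_nonneg (inv_nonneg.mpr hZpos.le) (heightDensity_nonneg F γ hJK _ U)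
    have := (ENNReal.ofReal_eq_ofReal_iff hρ0 hg0).mp hU
    rw [this, ← mul_assoc, mul_inv_cancel₀ hZpos.ne', one_mul]
  have hcont : ContinuousOn (fun U => Z * ρ U) W := continuousOn_const.mul hρc
  exact ⟨Node00.subset_regSet hWo ⟨_, hcont, hae'⟩, Node00.canonVersion_eqOn_of_continuousOn hWo hcont hae'⟩

/-- ★★ **PREG AT DEPTH `M = 0` WITH VERS's `(ν, ρ)` PREFIX** (every family, every `γ > 0`, every `J ≤ K`): the line's `partialDensityCan F γ b₀ p₀ hJK 0 U`
(= `heightDensityCan` of the depth-filtered event at depth `0`, written out; `δ`-equal to the line's) is POSITIVE at every window point once the nested law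
`ν_{K,J}` has a continuous positive window version `ρ` — it equals `Z_K·ρ` there (§3).  As LETTERED (no `(ν, ρ)`), PREG at `M = 0`, `K > J` reads an `rnDeriv`
point value and is not claimed. [cite: Balaban1985UV3, (2) p.256 and (6)-(7) p.257; Balaban1987RG1, (0.13) p.254] -/
theorem partialWindowPositivity_zero (F : T3Family) (γ b₀ p₀ : ℝ) (hγ : 0 < γ)
    (ν : ℕ → (j : ℕ) → Measure (GaugeField (F.P j) 0 (Matrix.specialUnitaryGroup (Fin 2) ℂ)))
    (hKK : ∀ K, ν K K = T4GenFunBounds.gibbsMeasure (F.P K) ((F.scheme ℰp γ).β K))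
    (hstep : ∀ K j, j < K → ν K j = Measure.map (descend F ℰp j) (ν K (j + 1)))
    (J K : ℕ) (hJK : J ≤ K) (ρ : GaugeField (F.P J) 0 (Matrix.specialUnitaryGroup (Fin 2) ℂ) → ℝ)
    (hρpos : ∀ U, PlaqSmall (θBal F.L γ b₀ p₀ J) U → 0 < ρ U)
    (hν : ν K J = (fieldMeasure _ _ _).withDensity (fun U => ENNReal.ofReal (ρ U)))
    (hρc : ContinuousOn ρ {U | PlaqSmall (θBal F.L γ b₀ p₀ J) U})
    (U : GaugeField (F.P J) 0 (Matrix.specialUnitaryGroup (Fin 2) ℂ)) (hU : PlaqSmall (θBal F.L γ b₀ p₀ J) U) :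
    0 < heightDensityCan F γ hJK {U : GaugeField (F.P K) 0 (Matrix.specialUnitaryGroup (Fin 2) ℂ) | ∀ j, j + J ≤ K → j < 0 →
      PlaqSmall (θBal F.L γ b₀ p₀ (K - j)) (Averaging.iter (fun i => BlockAveraging.blockAvg (P := F.P K) (j := i) ℰp) j U)} U := by
  have huniv : {U : GaugeField (F.P K) 0 (Matrix.specialUnitaryGroup (Fin 2) ℂ) | ∀ j, j + J ≤ K → j < 0 →
      PlaqSmall (θBal F.L γ b₀ p₀ (K - j)) (Averaging.iter (fun i => BlockAveraging.blockAvg (P := F.P K) (j := i) ℰp) j U)} = Set.univ := by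
    ext V
    simp
  rw [huniv, (subset_regSet_heightDensity_univ_of_version F b₀ p₀ hγ ν hKK hstep hJK ρ hρpos hν hρc).2 hU]
  exact mul_pos (partitionFn_pos' _ (F.scheme_β_nonneg ℰp hγ.le K)) (hρpos U hU)

end Shallow

end Summit.QuantumFields.YangMills.Theorems.FluctuationComparisonRegPrIntLOddsLedgerPregLow

end
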